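import Summits.BirchSwinnertonDyer.BirchSwinnertonDyer.Theorems.GoldfeldAllTwistsTwoConverseTwinAdditiveTamagawaTwoSeven
import Literature.NumberTheory.EllipticCurves.LocalTorsionAdditiveReductionPPrimaryProofs
import Literature.NumberTheory.EllipticCurves.GoodReductionTorsionReductionProofs
import Literature.NumberTheory.EllipticCurves.MazurTorsionOrderValuationProofs
import Literature.NumberTheory.EllipticCurves.BinaryQuarticStabilizerTorsion
import Literature.NumberTheory.EllipticCurves.ComplexMultiplicationNotSemistable
import Literature.NumberTheory.EllipticCurves.NoEverywhereGoodReductionRat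
import Literature.NumberTheory.EllipticCurves.BSDInvariantsProofs
import HarnessLib

set_option linter.dupNamespace false -- `…BirchSwinnertonDyer.BirchSwinnertonDyer…` is the cell's namespace (D-0017)
set_option autoImplicit false

/-!
# Twin″ (item 19140), the WHOLE additive cell — uniform arithmetic, VI: **`#W(ℚ)_tors = 2` for every model `W`
# of `49a1^{(d)}`, `d` squarefree, `d ≢ 1 (mod 4)`, `7 ∤ d`** — a Dirichlet-free proof through the two ADDITIVE primes

Cell `bsd-goldfeld`, seat `bsd-goldfeld-s1p-c301` (prover, gen 11). Support for item `stmt-BirchSwinnertonDyer-19140`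
(crux twin″ `BSDTwoCMSevenAdditiveRankOne`). Theses-free; theorems only; no `sorry`. HONEST FRAMING: the torsion term
`#W(ℚ)_tors²` of `#Ш_an(W)` for every curve of the additive cell; nothing about `L`-values; BSD is not proved by any of
this and no case of twin″ is claimed. (The family versions `torsionOrder_cm7_baseChange_eq_two{,_negEight}` of seat c301
gen 8/9 — F1/F2, over `K` — and seat c3's `#E₂(ℚ)_tors = 2` are the cases `d = −q, −2q, 2`.)

METHOD (no Dirichlet / Čebotarev, no Mazur; cf. the congruent-number file `CongruentNumberCurveTorsionProofs`, which
needs primes in progressions): on the global minimal model `X_d = X₀(49)^{(4d)} = M_d ⊗ ℚ` (file I) both `2` and `7` are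
primes of ADDITIVE reduction (`2, 7 ∣ Δ_min = −2¹²7³d⁶` and a CM curve is never multiplicative,
`not_hasMultiplicativeReductionAtPrime_of_hasCM`), so `[X(ℚ_p) : X₁(ℚ_p)] = c_p · #X̃_ns(𝔽_p) = c_p · p`
(`index_formalFiltration_one_of_additive`) is `c₂·2 = 8` at `2` and `c₇·7 = 14` at `7` (files IV: `c₂ = 4`, `c₇ = 2`),
while `X₁(ℚ_p)` has no prime-to-`p` torsion (`eq_zero_of_nsmul_eq_zero_of_isInReductionKernel`). Hence for a rational
torsion point `T` of order `m`: at `2`, the odd part of `m` divides `8` — it is `1`; at `7`, `2T` maps to `0` in a group of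
order `14` killed by... precisely: the image of `T` in `X(ℚ₇)/X₁` has order dividing `gcd(2^a, 14) ∣ 2`, so `2T ∈ X₁(ℚ₇)`
is a `2`-power torsion point of `X₁(ℚ₇)`, hence `0`. So **`2T = 0`** (`two_nsmul_eq_zero_of_isOfFinAddOrder_cellTwist`).
Finally `#X(ℚ)[2] = 2`: the `2`-division cubic is `4(x − 8d)(x² + 5dx + 8d²)` and `x² + 5dx + 8d² = (x + 5d/2)² + 7d²/4`
has no rational root (`natCard_torsionBy_two_cellTwist`), so **`#X(ℚ)_tors = 2`** (`torsionOrder_cellTwist`) and, `Tors`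
being a `ℚ`-isomorphism invariant (`torsionOrder_variableChange_holds`), **`W.torsionOrder = 2` for every model `W`**
(`torsionOrder_eq_two_of_smul_eq_cm7_quadraticTwist`).
CONSEQUENCE (with file V): for every curve `W` of the additive cell, `#Ш_an(W) = L^{(r)}(W,1)/r! · 4 / (Ω_W · 2^(3+ι+2σ) · Reg_W)`
— the uniform residual of twin″ is «`ord₂ (L′(W,1)/(Ω_W Reg_W)) = 1 + ι(d) + 2σ(d) + ord₂ #Ш(W)[2^∞]`».
References: [SilvermanAEC2009] VII.2.1, VII.3.1, VII.6.1, VIII.7, X.5 Cor. 5.4; [Silverman1994] IV.9 Table 4.1;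
[Olson1974] (the CM torsion table: `j = −3375 ⇒ E(ℚ)_tors ≅ ℤ/2`, here re-proved for the additive twists).
-/

noncomputable section

open scoped Classical NumberField

open WeierstrassCurve IsDedekindDomain IsLocalRing Rat.HeightOneSpectrum
  Literature.NumberTheory.EllipticCurves Literature.NumberTheory.EllipticCurves.ModularForms
  Literature.NumberTheory.QuadraticForms
  Summit.BirchSwinnertonDyer.BirchSwinnertonDyer.Rank2Observatory.Tate
  Summit.BirchSwinnertonDyer.BirchSwinnertonDyer.Rank2Observatory.RootNumber

namespace Summit.BirchSwinnertonDyer.BirchSwinnertonDyer.Theorems.GoldfeldGoodTwists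

section Torsion

variable {d : ℤ}

/-! ## §1 The global minimal model `X_d = X₀(49)^{(4d)}`: `Δ_min`, CM, additive reduction at `2` and `7` -/

/-- `X₀(49)^{(4d)} = M_d ⊗ ℚ` is globally minimal (file I, transported along `cellModel_baseChange`).
[cite: Kraus1989, Prop. 2] -/
theorem isGloballyMinimal_cellTwist (hsq : Squarefree d) (hd4 : d % 4 ≠ 1) :
    (cm7.quadraticTwist (((4 * d : ℤ)) : ℚ)).IsGloballyMinimal := by
  rw [← cellModel_baseChange]; exact isGloballyMinimal_cellModel hsq hd4

/-- `Δ_min(X_d) = −2¹²·7³·d⁶`. [cite: SilvermanAEC2009, VIII.8] -/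
theorem minimalDiscriminantInt_cellTwist (hsq : Squarefree d) (hd4 : d % 4 ≠ 1) :
    (haveI := isGloballyMinimal_cellTwist hsq hd4
     minimalDiscriminantInt (cm7.quadraticTwist (((4 * d : ℤ)) : ℚ))) = -(2 ^ 12 * 7 ^ 3 * d ^ 6) := by
  haveI := isGloballyMinimal_cellTwist hsq hd4
  have h := cast_minimalDiscriminantInt (cm7.quadraticTwist (((4 * d : ℤ)) : ℚ))
  have hΔ : (cm7.quadraticTwist (((4 * d : ℤ)) : ℚ)).Δ = (((-(2 ^ 12 * 7 ^ 3 * d ^ 6) : ℤ)) : ℚ) := by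
    rw [← cellModel_baseChange, ← cellModel_Δ d]
    simp [baseChange, map_Δ]
  rw [hΔ] at h
  exact_mod_cast h

/-- `j(X_d) = −3375`, so `X_d` has CM (by `ℤ[(1+√−7)/2]`). [cite: SilvermanATAEC1994, App. A §3] -/
theorem hasCM_cellTwist (hd0 : d ≠ 0) :
    (haveI := cm7.isElliptic_quadraticTwist (show (((4 * d : ℤ)) : ℚ) ≠ 0 by
       exact_mod_cast (show (4 * d : ℤ) ≠ 0 by omega))
     (cm7.quadraticTwist (((4 * d : ℤ)) : ℚ)).HasCM) := by
  have hd : (((4 * d : ℤ)) : ℚ) ≠ 0 := by exact_mod_cast (show (4 * d : ℤ) ≠ 0 by omega)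
  haveI := cm7.isElliptic_quadraticTwist hd
  exact hasCM_of_j_eq_neg3375 _ (by rw [j_quadraticTwist cm7 hd, j_cm7])

/-- `X_d` is ADDITIVE at `2` and at `7` (bad: `2, 7 ∣ Δ_min`; not multiplicative: CM).
[cite: SilvermanAEC2009, VII.5 Prop. 5.1] [cite: SilvermanATAEC1994, IV.9 Table 4.1] -/
theorem additive_two_seven_cellTwist (hsq : Squarefree d) (hd4 : d % 4 ≠ 1) :
    (haveI := isGloballyMinimal_cellTwist hsq hd4
     haveI := cm7.isElliptic_quadraticTwist (show (((4 * d : ℤ)) : ℚ) ≠ 0 by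
       have := hsq.ne_zero; exact_mod_cast (show (4 * d : ℤ) ≠ 0 by omega))
     haveI : Fact (Nat.Prime 7) := ⟨by norm_num⟩
     (¬ (cm7.quadraticTwist (((4 * d : ℤ)) : ℚ)).HasGoodReductionAtPrime 2 ∧
        ¬ (cm7.quadraticTwist (((4 * d : ℤ)) : ℚ)).HasMultiplicativeReductionAtPrime 2) ∧
      (¬ (cm7.quadraticTwist (((4 * d : ℤ)) : ℚ)).HasGoodReductionAtPrime 7 ∧
        ¬ (cm7.quadraticTwist (((4 * d : ℤ)) : ℚ)).HasMultiplicativeReductionAtPrime 7)) := by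
  haveI := isGloballyMinimal_cellTwist hsq hd4
  have hd0 : d ≠ 0 := hsq.ne_zero
  have hd : (((4 * d : ℤ)) : ℚ) ≠ 0 := by exact_mod_cast (show (4 * d : ℤ) ≠ 0 by omega)
  haveI := cm7.isElliptic_quadraticTwist hd
  haveI : Fact (Nat.Prime 7) := ⟨by norm_num⟩
  have hCM := hasCM_cellTwist hd0
  have hΔ := minimalDiscriminantInt_cellTwist hsq hd4
  refine ⟨⟨not_hasGoodReductionAtPrime_of_dvd_minimalDiscriminantInt _ 2 ?_,
      not_hasMultiplicativeReductionAtPrime_of_hasCM _ hCM 2⟩,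
    ⟨not_hasGoodReductionAtPrime_of_dvd_minimalDiscriminantInt _ 7 ?_,
      not_hasMultiplicativeReductionAtPrime_of_hasCM _ hCM 7⟩⟩
  · rw [hΔ]; exact Dvd.dvd.neg_right ⟨2 ^ 11 * 7 ^ 3 * d ^ 6, by ring⟩
  · rw [hΔ]; exact Dvd.dvd.neg_right ⟨2 ^ 12 * 7 ^ 2 * d ^ 6, by ring⟩

/-! ## §2 The local step: `[X(ℚ_p) : X₁(ℚ_p)] = c_p·p` kills prime-to-`p` torsion beyond its gcd with `c_p·p` -/

/-- **Local killing lemma** (`X/ℚ` globally minimal, `p` prime, `T ∈ X(ℚ)`, `T'` its image in `X(ℚ_p)`): if `n • T'` lies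
in `X₁(ℚ_p)` and is killed by some `k` with `p ∤ k`, then `n • T = 0` — `X₁(ℚ_p)` has no prime-to-`p` torsion
(`eq_zero_of_nsmul_eq_zero_of_isInReductionKernel`) and `X(ℚ) → X(ℚ_p)` is injective.
[cite: SilvermanAEC2009, VII.3 Prop. 3.1(a) and IV.3.2(b)] -/
theorem nsmul_eq_zero_of_local {X : WeierstrassCurve ℚ} [X.IsElliptic] [X.IsGloballyMinimal] {p : ℕ} [Fact p.Prime]
    (T : X.toAffine.Point) (n k : ℕ) (hk : ¬ p ∣ k)
    (hker : (X.baseChange ℚ_[p]).IsInReductionKernel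
      (n • Affine.Point.map (W' := X.toAffine) (S := ℚ) (Algebra.ofId ℚ ℚ_[p]) T))
    (hkill : k • (n • Affine.Point.map (W' := X.toAffine) (S := ℚ) (Algebra.ofId ℚ ℚ_[p]) T) = 0) :
    n • T = 0 := by
  haveI : (X.baseChange ℚ_[p]).IsMinimal ℤ_[p] := isMinimal_map_padic_of_isGloballyMinimal X p
  haveI : (X.baseChange ℚ_[p]).IsElliptic := inferInstanceAs (X.map (algebraMap ℚ ℚ_[p])).IsElliptic
  have h0 := (X.baseChange ℚ_[p]).eq_zero_of_nsmul_eq_zero_of_isInReductionKernel hk hker hkill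
  rw [← map_nsmul] at h0
  exact (Affine.Point.map_injective (W' := X.toAffine) (f := Algebra.ofId ℚ ℚ_[p]))
    (h0.trans (map_zero _).symm)

/-- **In `X(ℚ_p)/X₁(ℚ_p)`, a finite group of order `N = [X(ℚ_p) : X₁(ℚ_p)]`, the class of a point `Q` with `m • Q = 0`
has order dividing `gcd(m, N)`**; so `g • Q ∈ X₁(ℚ_p)` whenever `gcd(m, N) ∣ g`. [cite: SilvermanAEC2009, VII.2 Prop. 2.1] -/
theorem nsmul_mem_formalFiltration_one {p : ℕ} [Fact p.Prime] (Y : WeierstrassCurve ℚ_[p]) [Y.IsIntegral ℤ_[p]]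
    [Y.IsElliptic] (Q : Y.toAffine.Point) {m g N : ℕ} (hmQ : m • Q = 0) (hN : (Y.formalFiltration 1).index = N)
    (hg : Nat.gcd m N ∣ g) : Y.IsInReductionKernel (g • Q) := by
  set H := Y.formalFiltration 1 with hH
  -- the class of `Q` in the quotient has order dividing `m` and `N`
  set x : Y.toAffine.Point ⧸ H := QuotientAddGroup.mk' H Q with hx
  have h1 : addOrderOf x ∣ m := by
    refine addOrderOf_dvd_of_nsmul_eq_zero ?_
    rw [hx, ← map_nsmul, hmQ, map_zero]
  have h2 : addOrderOf x ∣ N := by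
    rw [← hN]
    exact addOrderOf_dvd_natCard x
  have h3 : addOrderOf x ∣ g := (Nat.dvd_gcd h1 h2).trans hg
  have h4 : g • x = 0 := addOrderOf_dvd_iff_nsmul_eq_zero.mp h3
  have h5 : QuotientAddGroup.mk' H (g • Q) = 0 := by rw [map_nsmul, ← hx, h4]
  rw [QuotientAddGroup.mk'_apply, QuotientAddGroup.eq_zero_iff, hH, Y.formalFiltration_one_eq_zero,
    Y.mem_formalFiltration_zero_iff] at h5
  exact h5

/-! ## §3 Every rational torsion point of `X_d` is killed by `2` -/

/-- `gcd(2^a · m', 8) ∣ 2^a` for odd `m'`. [folklore] -/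
theorem gcd_two_pow_mul_odd_eight_dvd {a m' : ℕ} (hm' : Odd m') : Nat.gcd (2 ^ a * m') 8 ∣ 2 ^ a := by
  have hcop : Nat.Coprime m' 8 := by
    rw [show (8 : ℕ) = 2 ^ 3 by norm_num]
    exact Nat.Coprime.pow_right 3 ((Nat.Prime.coprime_iff_not_dvd Nat.prime_two).mpr
      (fun h => (Nat.not_even_iff_odd.mpr hm') (even_iff_two_dvd.mpr h))).symm
  rw [Nat.Coprime.gcd_mul_right_cancel (2 ^ a) hcop]
  exact Nat.gcd_dvd_left _ _

/-- `gcd(2^a, 14) ∣ 2`. [folklore] -/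
theorem gcd_two_pow_fourteen_dvd_two (a : ℕ) : Nat.gcd (2 ^ a) 14 ∣ 2 := by
  have h7 : Nat.Coprime (Nat.gcd (2 ^ a) 14) 7 :=
    Nat.Coprime.coprime_dvd_left (Nat.gcd_dvd_left _ _) (Nat.Coprime.pow_left a (by norm_num))
  exact h7.dvd_of_dvd_mul_right (show Nat.gcd (2 ^ a) 14 ∣ 2 * 7 by norm_num; exact Nat.gcd_dvd_right _ _)

/-- **`2 • T = 0` for every rational torsion point `T` of `X_d = X₀(49)^{(4d)}`** (`d` squarefree, `d ≢ 1 (mod 4)`, `7 ∤ d`):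
at the additive prime `2`, `[X(ℚ₂) : X₁] = c₂·2 = 8` and `X₁(ℚ₂)` has no odd torsion ⇒ the order `m = 2^a·m'` of `T` has
`2^a • T = 0`; at the additive prime `7`, `[X(ℚ₇) : X₁] = c₇·7 = 14`, `gcd(2^a, 14) ∣ 2` ⇒ `2T ∈ X₁(ℚ₇)`, which has no
`2`-power torsion ⇒ `2T = 0`. [cite: SilvermanAEC2009, VII.2.1, VII.3.1(a), IV.6.1] -/
theorem two_nsmul_eq_zero_of_isOfFinAddOrder_cellTwist (hsq : Squarefree d) (hd4 : d % 4 ≠ 1) (h7 : ¬ (7 : ℤ) ∣ d)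
    (T : (haveI := cm7.isElliptic_quadraticTwist (show (((4 * d : ℤ)) : ℚ) ≠ 0 by
       have := hsq.ne_zero; exact_mod_cast (show (4 * d : ℤ) ≠ 0 by omega))
     (cm7.quadraticTwist (((4 * d : ℤ)) : ℚ)).toAffine.Point)) (hT : IsOfFinAddOrder T) :
    (2 : ℕ) • T = 0 := by
  have hd0 : d ≠ 0 := hsq.ne_zero
  have hd : (((4 * d : ℤ)) : ℚ) ≠ 0 := by exact_mod_cast (show (4 * d : ℤ) ≠ 0 by omega)
  haveI := cm7.isElliptic_quadraticTwist hd
  haveI := isGloballyMinimal_cellTwist hsq hd4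
  haveI h7p : Fact (Nat.Prime 7) := ⟨by norm_num⟩
  obtain ⟨⟨hng2, hnm2⟩, ⟨hng7, hnm7⟩⟩ := additive_two_seven_cellTwist hsq hd4
  -- local indices `[X(ℚ_p) : X₁(ℚ_p)] = c_p · p`
  have hidx2 : (((cm7.quadraticTwist (((4 * d : ℤ)) : ℚ)).baseChange ℚ_[2]).formalFiltration 1).index = 8 := by
    rw [index_formalFiltration_one_of_additive _ 2 hng2 hnm2, localTamagawaNumber_padic_cellTwist_two hsq hd4]
  have hidx7 : (((cm7.quadraticTwist (((4 * d : ℤ)) : ℚ)).baseChange ℚ_[7]).formalFiltration 1).index = 14 := by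
    rw [index_formalFiltration_one_of_additive _ 7 hng7 hnm7, localTamagawaNumber_padic_cellTwist_seven h7]
  haveI : ((cm7.quadraticTwist (((4 * d : ℤ)) : ℚ)).baseChange ℚ_[2]).IsMinimal ℤ_[2] :=
    isMinimal_map_padic_of_isGloballyMinimal _ 2
  haveI : ((cm7.quadraticTwist (((4 * d : ℤ)) : ℚ)).baseChange ℚ_[7]).IsMinimal ℤ_[7] :=
    isMinimal_map_padic_of_isGloballyMinimal _ 7
  haveI : ((cm7.quadraticTwist (((4 * d : ℤ)) : ℚ)).baseChange ℚ_[2]).IsElliptic :=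
    inferInstanceAs ((cm7.quadraticTwist (((4 * d : ℤ)) : ℚ)).map (algebraMap ℚ ℚ_[2])).IsElliptic
  haveI : ((cm7.quadraticTwist (((4 * d : ℤ)) : ℚ)).baseChange ℚ_[7]).IsElliptic :=
    inferInstanceAs ((cm7.quadraticTwist (((4 * d : ℤ)) : ℚ)).map (algebraMap ℚ ℚ_[7])).IsElliptic
  -- the order `m = 2^a · m'` of `T`
  have hm0 : addOrderOf T ≠ 0 := (hT.addOrderOf_pos).ne'
  have hmT : addOrderOf T • T = 0 := addOrderOf_nsmul_eq_zero T
  obtain ⟨a, m', hm', hmeq⟩ := Nat.exists_eq_two_pow_mul_odd hm0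
  -- (a) at `2`: `2^a • T = 0`
  set T₂ := Affine.Point.map (W' := (cm7.quadraticTwist (((4 * d : ℤ)) : ℚ)).toAffine) (S := ℚ)
    (Algebra.ofId ℚ ℚ_[2]) T with hT₂
  have hordT₂ : addOrderOf T₂ = addOrderOf T := addOrderOf_injective _
    (Affine.Point.map_injective (W' := (cm7.quadraticTwist (((4 * d : ℤ)) : ℚ)).toAffine) (f := Algebra.ofId ℚ ℚ_[2])) T
  have hmT₂ : addOrderOf T • T₂ = 0 := by rw [← hordT₂]; exact addOrderOf_nsmul_eq_zero T₂
  have hmeq' : m' * 2 ^ a = addOrderOf T := by rw [hmeq, Nat.mul_comm]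
  have hker2 : ((cm7.quadraticTwist (((4 * d : ℤ)) : ℚ)).baseChange ℚ_[2]).IsInReductionKernel ((2 ^ a) • T₂) := by
    refine nsmul_mem_formalFiltration_one _ T₂ hmT₂ hidx2 ?_
    rw [hmeq]
    exact gcd_two_pow_mul_odd_eight_dvd hm'
  have hkill2 : m' • ((2 ^ a) • T₂) = 0 := by
    rw [← mul_nsmul', hmeq']; exact hmT₂
  have hm'2 : ¬ 2 ∣ m' := fun h => (Nat.not_even_iff_odd.mpr hm') (even_iff_two_dvd.mpr h)
  have ha : (2 ^ a) • T = 0 := nsmul_eq_zero_of_local T (2 ^ a) m' hm'2 hker2 hkill2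
  -- (b) at `7`: `2 • T = 0`
  set T₇ := Affine.Point.map (W' := (cm7.quadraticTwist (((4 * d : ℤ)) : ℚ)).toAffine) (S := ℚ)
    (Algebra.ofId ℚ ℚ_[7]) T with hT₇
  have hordT₇ : addOrderOf T₇ = addOrderOf T := addOrderOf_injective _
    (Affine.Point.map_injective (W' := (cm7.quadraticTwist (((4 * d : ℤ)) : ℚ)).toAffine) (f := Algebra.ofId ℚ ℚ_[7])) T
  have haT₇ : (2 ^ a) • T₇ = 0 := by
    rw [← addOrderOf_dvd_iff_nsmul_eq_zero, hordT₇]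
    exact addOrderOf_dvd_of_nsmul_eq_zero ha
  have hker7 : ((cm7.quadraticTwist (((4 * d : ℤ)) : ℚ)).baseChange ℚ_[7]).IsInReductionKernel (2 • T₇) :=
    nsmul_mem_formalFiltration_one _ T₇ haT₇ hidx7 (gcd_two_pow_fourteen_dvd_two a)
  have hkill7 : (2 ^ a) • (2 • T₇) = 0 := by
    rw [← mul_nsmul', (Nat.mul_comm (2 ^ a) 2 : 2 ^ a * 2 = 2 * 2 ^ a), mul_nsmul', haT₇, nsmul_zero]
  have h72 : ¬ 7 ∣ 2 ^ a := fun h => by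
    have := (Nat.Prime.dvd_of_dvd_pow (by norm_num : Nat.Prime 7) h)
    omega
  exact nsmul_eq_zero_of_local T 2 (2 ^ a) h72 hker7 hkill7

/-! ## §4 `#X_d(ℚ)[2] = 2`, `#X_d(ℚ)_tors = 2`, and the same for every model -/

/-- Bookkeeping: `Nat.card X(ℚ)[2]` does not depend on the `DecidableEq ℚ` instance carried by Mathlib's group law on
affine points (`DecidableEq ℚ` is a subsingleton) — the tree lemma `natCard_torsionBy_two_eq` is stated over a general
field with the classical instance, this file's statements with `ℚ`'s own (cf. `MazurTorsionOrderValuationProofs`). [folklore] -/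
private theorem natCard_torsionBy_two_eq_of_subsingleton (W : WeierstrassCurve ℚ) (d₁ d₂ : DecidableEq ℚ) :
    Nat.card (@AddSubgroup.torsionBy W.toAffine.Point
        (@WeierstrassCurve.Affine.Point.instAddCommGroup ℚ _ W.toAffine d₁) (2 : ℤ)) =
      Nat.card (@AddSubgroup.torsionBy W.toAffine.Point
        (@WeierstrassCurve.Affine.Point.instAddCommGroup ℚ _ W.toAffine d₂) (2 : ℤ)) := by
  obtain rfl : d₁ = d₂ := Subsingleton.elim _ _
  rfl

/-- **`#X_d(ℚ)[2] = 2`**: the `2`-division cubic of `X_d = [0, −3d, 0, −32d², −64d³] ⊗ ℚ` is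
`4x³ − 12dx² − 128d²x − 256d³ = 4(x − 8d)(x² + 5dx + 8d²)`, and `x² + 5dx + 8d² = (x + 5d/2)² + 7d²/4 > 0`; so the only
rational root is `x = 8d`. [cite: SilvermanAEC2009, III.2 and Ex. 3.7] -/
theorem natCard_torsionBy_two_cellTwist (hd0 : d ≠ 0) :
    (haveI := cm7.isElliptic_quadraticTwist (show (((4 * d : ℤ)) : ℚ) ≠ 0 by
       exact_mod_cast (show (4 * d : ℤ) ≠ 0 by omega))
     Nat.card (AddSubgroup.torsionBy (cm7.quadraticTwist (((4 * d : ℤ)) : ℚ)).toAffine.Point (2 : ℤ))) = 2 := by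
  have hd : (((4 * d : ℤ)) : ℚ) ≠ 0 := by exact_mod_cast (show (4 * d : ℤ) ≠ 0 by omega)
  haveI := cm7.isElliptic_quadraticTwist hd
  have hroots : {x : ℚ | (cm7.quadraticTwist (((4 * d : ℤ)) : ℚ)).twoTorsionPolynomial.toPoly.IsRoot x} =
      {(8 * d : ℚ)} := by
    ext x
    rw [Set.mem_setOf_eq, Set.mem_singleton_iff, ← cellModel_baseChange]
    simp only [twoTorsionPolynomial, Cubic.toPoly, Polynomial.IsRoot.def, Polynomial.eval_add, Polynomial.eval_mul,
      Polynomial.eval_C, Polynomial.eval_pow, Polynomial.eval_X, b₂, b₄, b₆, baseChange, map_a₁, map_a₂, map_a₃,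
      map_a₄, map_a₆, algebraMap_int_eq, eq_intCast, Int.cast_zero, Int.cast_mul, Int.cast_neg, Int.cast_pow,
      Int.cast_ofNat]
    constructor
    · intro h
      have hfac : 4 * (x - 8 * d) * ((2 * x + 5 * d) ^ 2 + 7 * d ^ 2) = 0 := by linear_combination 4 * h
      have hd' : (d : ℚ) ≠ 0 := by exact_mod_cast hd0
      have hpos : (2 * x + 5 * (d : ℚ)) ^ 2 + 7 * (d : ℚ) ^ 2 ≠ 0 := by positivity
      rcases mul_eq_zero.mp hfac with h1 | h1
      · rcases mul_eq_zero.mp h1 with h2 | h2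
        · norm_num at h2
        · linear_combination h2
      · exact absurd h1 hpos
    · rintro rfl
      ring
  have h := WeierstrassCurve.natCard_torsionBy_two_eq (cm7.quadraticTwist (((4 * d : ℤ)) : ℚ))
    (by norm_num : (2 : ℚ) ≠ 0)
  rw [hroots, Set.ncard_singleton] at h
  exact (natCard_torsionBy_two_eq_of_subsingleton (cm7.quadraticTwist (((4 * d : ℤ)) : ℚ)) _ _).trans h

/-- **`#X_d(ℚ)_tors = 2`** for `X_d = X₀(49)^{(4d)}`, `d` squarefree, `d ≢ 1 (mod 4)`, `7 ∤ d`: every torsion point is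
`2`-torsion (§3) and `#X_d(ℚ)[2] = 2`. [cite: SilvermanAEC2009, VII.3 and VIII.7] [cite: Olson1974, Thm. 1 (j = −3375)] -/
theorem torsionOrder_cellTwist (hsq : Squarefree d) (hd4 : d % 4 ≠ 1) (h7 : ¬ (7 : ℤ) ∣ d) :
    (haveI := cm7.isElliptic_quadraticTwist (show (((4 * d : ℤ)) : ℚ) ≠ 0 by
       have := hsq.ne_zero; exact_mod_cast (show (4 * d : ℤ) ≠ 0 by omega))
     (cm7.quadraticTwist (((4 * d : ℤ)) : ℚ)).torsionOrder) = 2 := by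
  have hd0 : d ≠ 0 := hsq.ne_zero
  have hd : (((4 * d : ℤ)) : ℚ) ≠ 0 := by exact_mod_cast (show (4 * d : ℤ) ≠ 0 by omega)
  haveI := cm7.isElliptic_quadraticTwist hd
  rw [torsionOrder_eq_natCard_torsion (cm7.quadraticTwist (((4 * d : ℤ)) : ℚ))]
  have htors : AddCommGroup.torsion (cm7.quadraticTwist (((4 * d : ℤ)) : ℚ)).toAffine.Point =
      AddSubgroup.torsionBy (cm7.quadraticTwist (((4 * d : ℤ)) : ℚ)).toAffine.Point (2 : ℤ) := by
    ext T
    rw [AddCommGroup.mem_torsion]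
    constructor
    · intro hT
      have h2 := two_nsmul_eq_zero_of_isOfFinAddOrder_cellTwist hsq hd4 h7 T hT
      show (2 : ℤ) • T = 0
      rw [show (2 : ℤ) = ((2 : ℕ) : ℤ) by norm_num, natCast_zsmul]
      exact h2
    · intro hT
      have h2 : (2 : ℤ) • T = 0 := hT
      rw [show (2 : ℤ) = ((2 : ℕ) : ℤ) by norm_num, natCast_zsmul] at h2
      exact isOfFinAddOrder_iff_nsmul_eq_zero.mpr ⟨2, two_pos, h2⟩
  rw [htors]
  exact natCard_torsionBy_two_cellTwist hd0

/-- **`#W(ℚ)_tors = 2` FOR EVERY MODEL `W` of `49a1^{(d)}`** (`C • W = X₀(49)^{(d)}`, `d` squarefree, `d ≢ 1 (mod 4)`,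
`7 ∤ d`): `#E(ℚ)_tors` is a `ℚ`-isomorphism invariant (`torsionOrder_variableChange_holds`) and `W ≅ X₀(49)^{(4d)}`. The
torsion term `#W(ℚ)_tors² = 4` of `#Ш_an(W)` for every curve of the additive cell of twin″.
[cite: SilvermanAEC2009, VIII.7] [cite: Olson1974, Thm. 1 (j = −3375)] -/
theorem torsionOrder_eq_two_of_smul_eq_cm7_quadraticTwist (hsq : Squarefree d) (hd4 : d % 4 ≠ 1)
    (h7 : ¬ (7 : ℤ) ∣ d) (W : WeierstrassCurve ℚ) [W.IsElliptic] (C : VariableChange ℚ)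
    (hC : C • W = cm7.quadraticTwist (d : ℚ)) : W.torsionOrder = 2 := by
  have hd : (((4 * d : ℤ)) : ℚ) ≠ 0 := by
    have := hsq.ne_zero; exact_mod_cast (show (4 * d : ℤ) ≠ 0 by omega)
  haveI := cm7.isElliptic_quadraticTwist hd
  obtain ⟨C', hC'⟩ := exists_smul_eq_cellModel_baseChange W hC
  rw [cellModel_baseChange] at hC'
  have h := torsionOrder_variableChange_holds W C'
  unfold torsionOrder_variableChange at h
  rw [hC'] at h
  rw [← h]
  exact torsionOrder_cellTwist hsq hd4 h7

end Torsion

end Summit.BirchSwinnertonDyer.BirchSwinnertonDyer.Theorems.GoldfeldGoodTwists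

end
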